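import Mathlib
import Summits.MatrixMultiplication.MatrixMultiplication.Theses.GroupTheoreticSTPP
import Literature.Computability.AlgebraicComplexity.PrattTrapezoidValSDPP
import Literature.Computability.AlgebraicComplexity.GroupTheoreticMatMulThmBProofs

/-!
# Stub `stub_packingToCThesis` of line `two-families-salem-spencer` — crux `ThinPackings`

Route `MatrixMultiplication/ThinBlockAlpha`, crux `stmt-MatrixMultiplication-10595`
(`Summit.MatrixMultiplication.MatrixMultiplication.Theses.ThinBlockAlpha.ThinPackings`),
line `two-families-salem-spencer`, stub `stub_packingToCThesis : CPackingConstruction → CThesis`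
(both constants of route `GroupTheoreticSTPP`: CKSU 2005 Conj. 4.7 "two families" resp. `X_C`).

**Two families certify `X_C`** (Cohn–Kleinberg–Szegedy–Umans 2005, §4 and §6.2; the count is the
one in the proof of Pratt 2024, Thm. 4.7), explicit / elementary version with all constants fixed
in advance.  Given `ε > 0` put `t := min ε 1 / 10` and take, from `CPackingConstruction` at
`δ := t`, `n` pairs `(Aᵢ, Bᵢ)` with the simultaneous double product property in a finite abelian
group `H`, `|H| ≤ n^{2+t}`, `|Aᵢ||Bᵢ| ≥ n^{2-t}`, with `n` beyond two explicit thresholds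
(`n ≥ ⌈65^{1/ε}⌉`, so that `n^ε > 64`, and `n` large enough for Behrend at exponent `2 - t`).
Take a corner-free index configuration `k₁ k₂ k₃ : Fin L → Fin n` with `n^{2-t} ≤ 64 L` (tree:
`exists_cornerFree_indexMaps_card_ge`, Behrend + the standard corner-free subset of `Δₙ`) and the
CKSU triangle lift in `H³`,
`A'_x = A_{k₁x} × {0} × B_{k₃x}`, `B'_x = B_{k₁x} × A_{k₂x} × {0}`, `C'_x = {0} × B_{k₂x} × A_{k₃x}`,
an STPP family by the tree theorem `addSimultaneousTPP_of_sdpp`.  Each block has volume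
`∏_t |A_{k_t x}||B_{k_t x}| ≥ n^{3(2-t)}`, so
`64 |H³| ≤ 64 n^{6+3t} < n^{ε} n^{6+3t} ≤ n^{2-t} · n^{(2-t)(2+ε)} ≤ 64 Σ_x vol_x^{(2+ε)/3}`
(the middle step is `6t + tε ≤ ε`), which is the inequality of `CThesis` at `ε`.

References: CohnKleinbergSzegedyUmans2005 (arXiv:math/0511460) §4, §6.2; Pratt2024
(arXiv:2309.03878) proof of Thm. 4.7; tree file
`Literature/Computability/AlgebraicComplexity/PrattTrapezoidValSDPP.lean`.
-/

set_option linter.dupNamespace false  -- `Summit.<S>.<S>.…` is the mandated namespace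

namespace Summit.MatrixMultiplication.MatrixMultiplication.Theorems.ThinPackings.SalemSpencerLift

open Finset
open Literature.Computability.AlgebraicComplexity
open Summit.MatrixMultiplication.MatrixMultiplication.Theses.GroupTheoreticSTPP
  (CPackingConstruction CThesis)

/-- Explicit threshold: `64 < n ^ ε` as soon as `⌈65^{1/ε}⌉ ≤ n` (for `ε > 0`). -/
theorem sixtyfour_lt_rpow {ε : ℝ} (hε : 0 < ε) {n : ℕ} (hn : ⌈(65 : ℝ) ^ (1 / ε)⌉₊ ≤ n) :
    (64 : ℝ) < (n : ℝ) ^ ε := by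
  have h65 : (0 : ℝ) ≤ (65 : ℝ) ^ (1 / ε) := Real.rpow_nonneg (by norm_num) _
  have hle : (65 : ℝ) ^ (1 / ε) ≤ n := (Nat.le_ceil _).trans (by exact_mod_cast hn)
  have h := Real.rpow_le_rpow h65 hle hε.le
  rw [← Real.rpow_mul (by norm_num : (0 : ℝ) ≤ 65), one_div, inv_mul_cancel₀ hε.ne',
    Real.rpow_one] at h
  linarith

/-- Volume of one lifted block: if `p, q, r ≥ x^{2-t}` then
`x^{(2-t)(2+ε)} ≤ (p q r)^{(2+ε)/3}`. -/
theorem volume_rpow_ge {x t ε : ℝ} (hx : 0 < x) (hexp : 0 ≤ (2 + ε) / 3) {p q r : ℕ}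
    (hp : x ^ (2 - t) ≤ p) (hq : x ^ (2 - t) ≤ q) (hr : x ^ (2 - t) ≤ r) :
    x ^ ((2 - t) * (2 + ε)) ≤ ((p * q * r : ℕ) : ℝ) ^ ((2 + ε) / 3) := by
  have h0 : (0 : ℝ) ≤ x ^ (2 - t) := Real.rpow_nonneg hx.le _
  have hv : x ^ (2 - t) * (x ^ (2 - t) * x ^ (2 - t)) ≤ ((p * q * r : ℕ) : ℝ) := by
    rw [Nat.cast_mul, Nat.cast_mul, mul_assoc]
    exact mul_le_mul hp (mul_le_mul hq hr h0 (h0.trans hq)) (mul_nonneg h0 h0) (h0.trans hp)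
  calc x ^ ((2 - t) * (2 + ε))
      = (x ^ ((2 - t) + ((2 - t) + (2 - t)))) ^ ((2 + ε) / 3) := by
        rw [← Real.rpow_mul hx.le]; congr 1; ring
    _ = (x ^ (2 - t) * (x ^ (2 - t) * x ^ (2 - t))) ^ ((2 + ε) / 3) := by
        rw [Real.rpow_add hx (2 - t) ((2 - t) + (2 - t)), Real.rpow_add hx (2 - t) (2 - t)]
    _ ≤ ((p * q * r : ℕ) : ℝ) ^ ((2 + ε) / 3) :=
        Real.rpow_le_rpow (mul_nonneg h0 (mul_nonneg h0 h0)) hv hexp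

/-- The count, as pure arithmetic: `L` blocks each of weight `≥ x^{(2-t)(2+ε)}`,
`x^{2-t} ≤ 64 L`, host `≤ x^{6+3t}`, `64 < x^ε` and `6t + tε ≤ ε` (in the rearranged form
`ε + (6 + 3t) ≤ (2 - t) + (2 - t)(2 + ε)`) give `host < Σ weights`. -/
theorem count_core {L : ℕ} {x ε t card : ℝ} (f : Fin L → ℝ) (hx0 : 0 < x) (hx1 : 1 ≤ x)
    (h64 : 64 < x ^ ε) (hexp2 : ε + (6 + 3 * t) ≤ (2 - t) + (2 - t) * (2 + ε))
    (hterm : ∀ l, x ^ ((2 - t) * (2 + ε)) ≤ f l) (hL : x ^ (2 - t) ≤ 64 * (L : ℝ))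
    (hhost : card ≤ x ^ (6 + 3 * t)) : card < ∑ l, f l := by
  have hsum : (L : ℝ) * x ^ ((2 - t) * (2 + ε)) ≤ ∑ l, f l := by
    have h := Finset.card_nsmul_le_sum (Finset.univ : Finset (Fin L)) f _ fun l _ => hterm l
    rwa [Finset.card_univ, Fintype.card_fin, nsmul_eq_mul] at h
  have hmain : 64 * card < 64 * ∑ l, f l :=
    calc 64 * card ≤ 64 * x ^ (6 + 3 * t) := by gcongr
      _ < x ^ ε * x ^ (6 + 3 * t) := mul_lt_mul_of_pos_right h64 (Real.rpow_pos_of_pos hx0 _)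
      _ = x ^ (ε + (6 + 3 * t)) := (Real.rpow_add hx0 _ _).symm
      _ ≤ x ^ ((2 - t) + (2 - t) * (2 + ε)) := Real.rpow_le_rpow_of_exponent_le hx1 hexp2
      _ = x ^ (2 - t) * x ^ ((2 - t) * (2 + ε)) := Real.rpow_add hx0 _ _
      _ ≤ (64 * (L : ℝ)) * x ^ ((2 - t) * (2 + ε)) :=
          mul_le_mul_of_nonneg_right hL (Real.rpow_nonneg hx0.le _)
      _ = 64 * ((L : ℝ) * x ^ ((2 - t) * (2 + ε))) := mul_assoc _ _ _
      _ ≤ 64 * ∑ l, f l := mul_le_mul_of_nonneg_left hsum (by norm_num)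
  exact lt_of_mul_lt_mul_left hmain (by norm_num)

/-- **The CKSU triangle lift beats the host.**  For SDPP pairs `(Aᵢ, Bᵢ)_{i<n}` in a finite
abelian group `H` with `|H| ≤ n^{2+t}` and `|Aᵢ||Bᵢ| ≥ n^{2-t}`, a corner-free index
configuration `k₁ k₂ k₃ : Fin L → Fin n` with `n^{2-t} ≤ 64 L`, and parameters with
`6t + tε ≤ ε`, `64 < n^ε`, the lifted family
`(A_{k₁x} × {0} × B_{k₃x}, B_{k₁x} × A_{k₂x} × {0}, {0} × B_{k₂x} × A_{k₃x})_{x < L}` in `H³` is an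
STPP construction with `|H³| < Σ_x (|A'_x||B'_x||C'_x|)^{(2+ε)/3}` — a witness of `CThesis` at `ε`. -/
theorem lift_beats {H : Type} [AddCommGroup H] [Fintype H] {n : ℕ} {A B : Fin n → Finset H}
    (hD : ∀ i : Fin n, ∀ a ∈ A i, ∀ a' ∈ A i, ∀ b ∈ B i, ∀ b' ∈ B i,
      (a - a') + (b - b') = 0 → a = a' ∧ b = b')
    (hSD : ∀ i j k : Fin n, ∀ a ∈ A i, ∀ a' ∈ A j, ∀ b ∈ B j, ∀ b' ∈ B k,
      (a - a') + (b - b') = 0 → i = k)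
    {ε t : ℝ} (hε : 0 < ε) (ht6 : 6 * t + t * ε ≤ ε)
    (hn1 : 1 < (n : ℝ)) (h64 : (64 : ℝ) < (n : ℝ) ^ ε)
    (hH : (Fintype.card H : ℝ) ≤ (n : ℝ) ^ (2 + t))
    (hAB : ∀ i : Fin n, (n : ℝ) ^ (2 - t) ≤ (((A i).card * (B i).card : ℕ) : ℝ))
    {L : ℕ} (k₁ k₂ k₃ : Fin L → Fin n)
    (hcf : ∀ x y z : Fin L, k₁ x = k₁ z → k₂ y = k₂ x → k₃ z = k₃ y → x = y ∧ y = z)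
    (hL : (n : ℝ) ^ (2 - t) ≤ 64 * (L : ℝ)) :
    ∃ (H' : Type) (_ : AddCommGroup H') (_ : Fintype H') (N : ℕ) (A' B' C' : Fin N → Finset H'),
      (∀ i j k : Fin N, ∀ s ∈ A' k, ∀ s' ∈ A' i, ∀ t ∈ B' i, ∀ t' ∈ B' j, ∀ u ∈ C' j,
        ∀ u' ∈ C' k, (s' - s) + (t' - t) + (u' - u) = 0 →
          i = j ∧ j = k ∧ s = s' ∧ t = t' ∧ u = u') ∧
      (Fintype.card H' : ℝ) <
        ∑ i, (((A' i).card * (B' i).card * (C' i).card : ℕ) : ℝ) ^ ((2 + ε) / 3) := by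
  refine ⟨H × H × H, inferInstance, inferInstance, L,
    fun x => A (k₁ x) ×ˢ (({0} : Finset H) ×ˢ B (k₃ x)),
    fun x => B (k₁ x) ×ˢ (A (k₂ x) ×ˢ ({0} : Finset H)),
    fun x => ({0} : Finset H) ×ˢ (B (k₂ x) ×ˢ A (k₃ x)), ?_, ?_⟩
  · -- the STPP (CKSU §6.2 / proof of Pratt Thm. 4.7, proved in the tree)
    have hS := addSimultaneousTPP_of_sdpp hD hSD k₁ k₂ k₃ hcf
    exact (isSTPP_iff_addSimultaneousTPP _ _ _).2 hS
  · -- the count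
    have hx0 : (0 : ℝ) < n := by linarith
    have hx1 : (1 : ℝ) ≤ n := hn1.le
    have hp : ∀ r : ℝ, (0 : ℝ) ≤ (n : ℝ) ^ r := fun r => Real.rpow_nonneg hx0.le r
    -- host: `|H³| ≤ n^{6+3t}`
    have hH0 : (0 : ℝ) ≤ Fintype.card H := by positivity
    have hhost : (Fintype.card (H × H × H) : ℝ) ≤ (n : ℝ) ^ (6 + 3 * t) := by
      rw [Fintype.card_prod, Fintype.card_prod, Nat.cast_mul, Nat.cast_mul,
        show (6 + 3 * t : ℝ) = (2 + t) + ((2 + t) + (2 + t)) by ring,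
        Real.rpow_add hx0 (2 + t) ((2 + t) + (2 + t)), Real.rpow_add hx0 (2 + t) (2 + t)]
      exact mul_le_mul hH (mul_le_mul hH hH hH0 (hp _)) (mul_nonneg hH0 hH0) (hp _)
    -- each block: `n^{(2-t)(2+ε)} ≤ vol_x^{(2+ε)/3}`
    have hexp : (0 : ℝ) ≤ (2 + ε) / 3 := by linarith
    have hterm : ∀ l : Fin L, (n : ℝ) ^ ((2 - t) * (2 + ε)) ≤
        ((#(A (k₁ l) ×ˢ (({0} : Finset H) ×ˢ B (k₃ l))) *
            #(B (k₁ l) ×ˢ (A (k₂ l) ×ˢ ({0} : Finset H))) *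
            #(({0} : Finset H) ×ˢ (B (k₂ l) ×ˢ A (k₃ l))) : ℕ) : ℝ) ^ ((2 + ε) / 3) := by
      intro l
      rw [card_mul_card_mul_card_sdpp k₁ k₂ k₃ l]
      exact volume_rpow_ge hx0 hexp (hAB _) (hAB _) (hAB _)
    -- assemble
    have hexp2 : ε + (6 + 3 * t) ≤ (2 - t) + (2 - t) * (2 + ε) := by nlinarith [ht6]
    exact count_core _ hx0 hx1 h64 hexp2 hterm hL hhost

/-- **Stub `stub_packingToCThesis` (registered, verbatim): two families certify `X_C`.**
CKSU 2005 Conj. 4.7 (`CPackingConstruction`, item stmt-MatrixMultiplication-0595) implies `X_C`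
(`CThesis`, item stmt-MatrixMultiplication-0593) by the triangle lift over a Behrend corner-free
index set, with the explicit parameters `δ = η = min ε 1 / 10` and
`n ≥ n₁(Behrend) + ⌈65^{1/ε}⌉ + 2`. -/
theorem stub_packingToCThesis : CPackingConstruction → CThesis := by
  intro hP ε hε
  -- explicit parameters
  set t : ℝ := min ε 1 / 10 with ht
  have hmin0 : 0 < min ε 1 := lt_min hε one_pos
  have ht0 : 0 < t := by rw [ht]; exact div_pos hmin0 (by norm_num)
  have htε : t ≤ ε / 10 := by
    have := min_le_left ε 1
    rw [ht]; linarith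
  have ht1 : t ≤ 1 / 10 := by
    have := min_le_right ε 1
    rw [ht]; linarith
  have ht6 : 6 * t + t * ε ≤ ε := by
    have : t * ε ≤ 1 / 10 * ε := mul_le_mul_of_nonneg_right ht1 hε.le
    linarith
  -- Behrend corner-free configurations at exponent `2 - t`
  obtain ⟨n₁, hn₁⟩ := exists_cornerFree_indexMaps_card_ge t ht0 (by linarith)
  -- the two families at `δ = t`, beyond both thresholds
  obtain ⟨n, hn, H, _, _, A, B, hD, hSD, hH, hAB⟩ := hP t ht0 (n₁ + ⌈(65 : ℝ) ^ (1 / ε)⌉₊ + 2)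
  obtain ⟨ι₀, _, _, j₁, j₂, j₃, hcard, hcf⟩ := hn₁ n (by omega)
  have h64 : (64 : ℝ) < (n : ℝ) ^ ε := sixtyfour_lt_rpow hε (by omega)
  have hn1 : (1 : ℝ) < n := by exact_mod_cast (show 1 < n by omega)
  -- reindex the configuration by `Fin |ι₀|` and lift
  set e := (Fintype.equivFin ι₀).symm with he
  refine lift_beats hD hSD hε ht6 hn1 h64 hH hAB (j₁ ∘ e) (j₂ ∘ e) (j₃ ∘ e)
    (fun x y z h1 h2 h3 => ?_) hcard
  obtain ⟨hxy, hyz⟩ := hcf (e x) (e y) (e z) h1 h2 h3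
  exact ⟨e.injective hxy, e.injective hyz⟩

end Summit.MatrixMultiplication.MatrixMultiplication.Theorems.ThinPackings.SalemSpencerLift
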